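import Mathlib
import Summits.Ventures.PercRepro2.SwOutMixedCoreMoveUP
import Summits.Ventures.PercRepro2.SwOutMixedArmsBlockLower
import Summits.Ventures.PercRepro2.SwOutMixedArmsBaseReal

/-!
# The several-arms base: the pulled-back conditioning is NOT block-lower (blind cell PercRepro2,
night-4 g20, 2026-08-27; proofs/NIGHT4-G20.md §4″)

A kernel-checked counterexample to the planned geometric lift of `mixedArms_card_le` through
`BlockLower` (the several-arms twin of g18's `blockLower_tgtU`).  The base has seven vertices
`h = 0, w = 1 (the u-arm), u = 2, p₁ = 3, p₂ = 4 (two pure arms), l = 5, o = 6` and seven edges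
`h–w, u–w, u–p₁, u–p₂` (red), `p₁–l, p₂–o` (the outside edges, blue), `l–o` (red, in no class).
It is a `MixedBaseR` (`mixedBaseR_X`) with an edge between `u` and every dropped vertex, a region
`Us = {0, 1, 2, 3, 4}` not containing `l`, and `o ≠ u` — the hypotheses of the single-arm block
theorem.  At `q = (⊤, (1, 0), (1, 1))` the realisation lies in the conditioning
`tgtU l h {o ∈ ·}` (`C_R(l) = {l, o}`, `C_B(l) = {l, p₁}`); at `q₁ = (⊤, (0, 0), (1, 1)) ≤ q`,
both non-leaking, it does not: `u–p₁` turns blue and `C_B(l) ⊇ {l, p₁, u, p₂, o} ∋ o`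
(`not_blockLower_X`).  The mechanism: with a second arm, `u` is blue-joined to every dropped
vertex, and the T-slab drop of an arm merges the blue component of `l` with that of `u` — the
fact g18's `mem_tgtU_toggleUP_top` rests on ("`u` has no blue edge") fails.  The abstract
theorem is untouched; its hypothesis is the wrong one for several arms (the geometric inequality
itself holds on this base and on every base of the census, NIGHT4-G20.md §4″).
-/

namespace Summit.Ventures.PercRepro2

namespace MixedArms

open Hull LocRows BigBlock

open scoped Classical

section NotLower

/-- The seven edges: `h–w, u–w, u–p₁, u–p₂, p₁–l, p₂–o, l–o`. -/
def endsX : Fin 7 → Sym2 (Fin 7) :=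
  ![s(0, 1), s(2, 1), s(2, 3), s(2, 4), s(3, 5), s(4, 6), s(5, 6)]

/-- The base colouring: red at `h` and `u`, the outside edges blue, `l–o` red. -/
def σX : Config (Fin 7) := ![true, true, true, true, false, false, true]

/-- The single u-arm `{w}`. -/
def UX : Fin 1 → Set (Fin 7) := fun _ => {1}

/-- The dropped vertices `p₁ = 3`, `p₂ = 4`. -/
def pX : Fin 2 → Fin 7 := ![3, 4]

/-- No pieces. -/
def AhX : Fin 0 → Set (Fin 7) := Fin.elim0

/-- No pieces: the empty arm map. -/
def armX : Fin 0 → Fin 2 := Fin.elim0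

/-- No far arms. -/
def FX : Fin 0 → Set (Fin 7) := Fin.elim0

/-- The base is a several-arms base. -/
theorem mixedBaseR_X : MixedBaseR endsX σX 0 2 UX pX AhX armX FX where
  hne_hu := by decide
  hne_hp := by decide
  hne_up := by decide
  p_inj := by decide
  h_notMem_U := by intro j; simp [UX]
  u_notMem_U := by intro j; simp [UX]
  p_notMem_U := by intro r j; fin_cases r <;> simp [UX, pX]
  h_notMem_Ah := fun i => i.elim0
  u_notMem_Ah := fun i => i.elim0
  p_notMem_Ah := fun _ i => i.elim0
  h_notMem_F := fun k => k.elim0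
  u_notMem_F := fun k => k.elim0
  p_notMem_F := fun _ k => k.elim0
  U_disj := fun j j' h => absurd (Subsingleton.elim j j') h
  U_disj_Ah := fun _ i => i.elim0
  U_disj_F := fun _ k => k.elim0
  Ah_disj := fun i => i.elim0
  Ah_disj_F := fun i => i.elim0
  F_disj := fun k => k.elim0
  U_nonempty := fun _ => ⟨1, rfl⟩
  Ah_nonempty := fun i => i.elim0
  F_nonempty := fun k => k.elim0
  no_cross_UU := fun j j' h => absurd (Subsingleton.elim j j') h
  no_cross_UAh := fun _ i => i.elim0
  no_cross_UF := fun _ k => k.elim0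
  no_cross_AhAh := fun i => i.elim0
  no_cross_AhF := fun i => i.elim0
  no_cross_FF := fun k => k.elim0
  h_edges := by
    intro e x he
    fin_cases e <;> simp [endsX] at he
    subst he
    exact Or.inl ⟨0, rfl⟩
  u_edges := by
    intro e x he
    fin_cases e <;> simp [endsX] at he <;> subst he
    · exact Or.inl ⟨0, rfl⟩
    · exact Or.inr ⟨0, rfl⟩
    · exact Or.inr ⟨1, rfl⟩
  p_edges := by
    intro r e x he
    fin_cases r <;> fin_cases e <;> simp [endsX, pX] at he <;> subst he
    · exact Or.inl rfl
    · exact Or.inr (Or.inr ⟨by decide, by decide, by simp [armsAllR, UX, AhX, FX]⟩)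
    · exact Or.inl rfl
    · exact Or.inr (Or.inr ⟨by decide, by decide, by simp [armsAllR, UX, AhX, FX]⟩)
  u_adj_U := fun _ => ⟨1, 1, rfl, rfl⟩
  h_red := by decide
  u_red := by decide
  dead_blue := fun _ _ _ _ h => h.elim fun i _ => i.elim0
  ext_blue := by
    intro r e x he hx _
    fin_cases r <;> fin_cases e <;> simp [endsX, pX] at he <;> subst he <;>
      first | exact absurd rfl hx | rfl
  bdry_blue := by
    intro e x y he hx hyh hyu _ _
    simp only [armsAllR, UX, AhX, FX, Set.mem_union, Set.mem_iUnion, Set.mem_singleton_iff,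
      exists_const, IsEmpty.exists_iff, or_false] at hx
    subst hx
    fin_cases e <;> simp [endsX] at he <;> subst he
    · exact absurd rfl hyh
    · exact absurd rfl hyu
  U_conn := by
    intro j x hx
    rw [UX, Set.mem_singleton_iff] at hx
    subst hx
    refine mem_cluster_of_edge (mem_cluster_self _ _ _) (e := 0) ?_ rfl
    unfold insideConfig
    rw [Bool.and_eq_true]
    exact ⟨rfl, @decide_eq_true _ (Classical.propDecidable _)
      ⟨0, Or.inr rfl, 1, Or.inl rfl, rfl⟩⟩
  Ah_conn := fun i => i.elim0
  F_conn := fun k => k.elim0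

/-- An edge between `u` and every dropped vertex. -/
theorem hup_X : ∀ r, ∃ e, endsX e = s(2, pX r) := by decide

/-- The region `{h, u, p₁, p₂, w}`. -/
def UsX : Set (Fin 7) := {0, 1, 2, 3, 4}

/-- The region contains `h`, `u`, the dropped vertices and the arms. -/
theorem hUs_X : {0} ∪ {2} ∪ Set.range pX ∪ armsAllR UX AhX FX ⊆ UsX := by
  intro x hx
  simp only [armsAllR, UX, AhX, FX, Set.mem_union, Set.mem_iUnion, Set.mem_singleton_iff,
    exists_const, IsEmpty.exists_iff, or_false, Set.mem_range] at hx
  simp only [UsX, Set.mem_insert_iff, Set.mem_singleton_iff]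
  rcases hx with ((rfl | rfl) | ⟨r, rfl⟩) | rfl
  · exact Or.inl rfl
  · exact Or.inr (Or.inr (Or.inl rfl))
  · fin_cases r
    · exact Or.inr (Or.inr (Or.inr (Or.inl rfl)))
    · exact Or.inr (Or.inr (Or.inr (Or.inr rfl)))
  · exact Or.inr (Or.inl rfl)

/-- `l ∉ Us`. -/
theorem hl_X : (5 : Fin 7) ∉ UsX := by simp [UsX]

/-- The point `q = (⊤, (1, 0), (1, 1))`: arm 1 sealed, arm 2 dropped, both outside classes blue. -/
def qX : PtR (Fin 1) (Fin 2) (Fin 0) (Fin 0) :=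
  (fun _ => true, Fin.elim0, ![true, false], ![true, true], Fin.elim0)

/-- The point `q₁ = (⊤, (0, 0), (1, 1))`: both arms dropped. -/
def q1X : PtR (Fin 1) (Fin 2) (Fin 0) (Fin 0) :=
  (fun _ => true, Fin.elim0, ![false, false], ![true, true], Fin.elim0)

/-- The realisation of `q`: `u–p₂` blue, the outside edges blue, the rest red. -/
def ζX : Config (Fin 7) := ![true, true, true, false, false, false, true]

/-- The realisation of `q₁`: also `u–p₁` blue. -/
def ζ1X : Config (Fin 7) := ![true, true, false, false, false, false, true]

/-- The edge `0` touches the u-arm. -/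
lemma e0_touches : (0 : Fin 7) ∈ touches endsX (UX 0) := ⟨1, rfl, 0, Sym2.eq_swap⟩

/-- The edge `1` touches the u-arm. -/
lemma e1_touches : (1 : Fin 7) ∈ touches endsX (UX 0) := ⟨1, rfl, 2, Sym2.eq_swap⟩

/-- The edge `2` is the u–p₁ edge. -/
lemma e2_UP : (2 : Fin 7) ∈ clsUPR endsX 2 pX 0 := rfl

/-- The edge `3` is the u–p₂ edge. -/
lemma e3_UP : (3 : Fin 7) ∈ clsUPR endsX 2 pX 1 := rfl

/-- The edge `4` is the outside edge of `p₁`. -/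
lemma e4_Ext : (4 : Fin 7) ∈ clsExtR endsX 2 pX AhX 0 := ⟨5, rfl, by decide, fun i => i.elim0⟩

/-- The edge `5` is the outside edge of `p₂`. -/
lemma e5_Ext : (5 : Fin 7) ∈ clsExtR endsX 2 pX AhX 1 := ⟨6, rfl, by decide, fun i => i.elim0⟩

/-- The edge `6` (`l–o`) is in no class. -/
lemma e6_none (q : PtR (Fin 1) (Fin 2) (Fin 0) (Fin 0)) :
    mixedRealR endsX 2 UX pX AhX FX σX q 6 = σX 6 := by
  refine MixedBaseR.mixedRealR_apply_none ?_ (fun i => i.elim0) ?_ ?_ (fun k => k.elim0)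
  · rintro j ⟨x, hx, y, hxy⟩
    rw [UX, Set.mem_singleton_iff] at hx
    subst hx
    simp [endsX] at hxy
  · intro r h
    fin_cases r <;> simp [clsUPR, endsX, pX] at h
  · rintro r ⟨x, hx, -, -⟩
    fin_cases r <;> simp [endsX, pX] at hx

/-- The realisation of `q`. -/
theorem real_qX : mixedRealR endsX 2 UX pX AhX FX σX qX = ζX := by
  funext e
  fin_cases e
  · exact (by rw [mixedBaseR_X.mixedRealR_apply_U e0_touches]; rfl :
      mixedRealR endsX 2 UX pX AhX FX σX qX 0 = ζX 0)
  · exact (by rw [mixedBaseR_X.mixedRealR_apply_U e1_touches]; rfl :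
      mixedRealR endsX 2 UX pX AhX FX σX qX 1 = ζX 1)
  · exact (by rw [mixedBaseR_X.mixedRealR_apply_UP e2_UP]; rfl :
      mixedRealR endsX 2 UX pX AhX FX σX qX 2 = ζX 2)
  · exact (by rw [mixedBaseR_X.mixedRealR_apply_UP e3_UP]; rfl :
      mixedRealR endsX 2 UX pX AhX FX σX qX 3 = ζX 3)
  · exact (by rw [mixedBaseR_X.mixedRealR_apply_Ext e4_Ext]; rfl :
      mixedRealR endsX 2 UX pX AhX FX σX qX 4 = ζX 4)
  · exact (by rw [mixedBaseR_X.mixedRealR_apply_Ext e5_Ext]; rfl :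
      mixedRealR endsX 2 UX pX AhX FX σX qX 5 = ζX 5)
  · exact (by rw [e6_none]; rfl : mixedRealR endsX 2 UX pX AhX FX σX qX 6 = ζX 6)

/-- The realisation of `q₁`. -/
theorem real_q1X : mixedRealR endsX 2 UX pX AhX FX σX q1X = ζ1X := by
  funext e
  fin_cases e
  · exact (by rw [mixedBaseR_X.mixedRealR_apply_U e0_touches]; rfl :
      mixedRealR endsX 2 UX pX AhX FX σX q1X 0 = ζ1X 0)
  · exact (by rw [mixedBaseR_X.mixedRealR_apply_U e1_touches]; rfl :
      mixedRealR endsX 2 UX pX AhX FX σX q1X 1 = ζ1X 1)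
  · exact (by rw [mixedBaseR_X.mixedRealR_apply_UP e2_UP]; rfl :
      mixedRealR endsX 2 UX pX AhX FX σX q1X 2 = ζ1X 2)
  · exact (by rw [mixedBaseR_X.mixedRealR_apply_UP e3_UP]; rfl :
      mixedRealR endsX 2 UX pX AhX FX σX q1X 3 = ζ1X 3)
  · exact (by rw [mixedBaseR_X.mixedRealR_apply_Ext e4_Ext]; rfl :
      mixedRealR endsX 2 UX pX AhX FX σX q1X 4 = ζ1X 4)
  · exact (by rw [mixedBaseR_X.mixedRealR_apply_Ext e5_Ext]; rfl :
      mixedRealR endsX 2 UX pX AhX FX σX q1X 5 = ζ1X 5)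
  · exact (by rw [e6_none]; rfl : mixedRealR endsX 2 UX pX AhX FX σX q1X 6 = ζ1X 6)

/-- A closed set of vertices contains the cluster of its members (decidable form of the closure
lemma: the open adjacency unfolded). -/
lemma closed_of_decide {ζ : Config (Fin 7)} {S : Set (Fin 7)} {v : Fin 7} (hv : v ∈ S)
    (hS : ∀ x ∈ S, ∀ y, (x ≠ y ∧ OpenAdj endsX ζ x y) → y ∈ S) :
    cluster endsX ζ v ⊆ S := by
  intro x hx
  exact mem_of_conn_of_closed (fun a ha b hab => hS a ha b (openGraph_adj.1 hab)) hv hx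

/-- At `q`: `o` is in the red cluster of `l` (the edge `l–o`). -/
lemma o_mem_red_X : (6 : Fin 7) ∈ cluster endsX ζX 5 :=
  mem_cluster_of_edge (mem_cluster_self _ _ _) (e := 6) rfl rfl

/-- At `q`: the red cluster of `l` is inside `{l, o}`. -/
lemma red_X_subset : cluster endsX ζX 5 ⊆ {x | x = 5 ∨ x = 6} :=
  closed_of_decide (Or.inl rfl) (by decide)

/-- At `q`: the blue cluster of `l` is inside `{l, p₁}`. -/
lemma blue_X_subset : cluster endsX (blue ζX) 5 ⊆ {x | x = 5 ∨ x = 3} :=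
  closed_of_decide (Or.inl rfl) (by decide)

/-- At `q₁`: `o` is in the blue cluster of `l` (`l–p₁–u–p₂–o`). -/
lemma o_mem_blue_q1X : (6 : Fin 7) ∈ cluster endsX (blue ζ1X) 5 :=
  mem_cluster_of_edge (mem_cluster_of_edge (mem_cluster_of_edge (mem_cluster_of_edge
    (mem_cluster_self _ _ _) (e := 4) rfl Sym2.eq_swap) (e := 2) rfl Sym2.eq_swap)
    (e := 3) rfl rfl) (e := 5) rfl rfl

/-- `q` is not leaking. -/
lemma not_leak_qX : ¬ Leak qX armX := by
  unfold Leak LeakArm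
  decide

/-- `q₁` is not leaking. -/
lemma not_leak_q1X : ¬ Leak q1X armX := by
  unfold Leak LeakArm
  decide

/-- `q₁ ≤ q`. -/
lemma q1X_le_qX : q1X ≤ qX := by
  refine ⟨le_rfl, le_rfl, ?_, le_rfl, le_rfl⟩
  intro r
  fin_cases r <;> decide

/-- **The pulled-back conditioning of the base is not block-lower**: `q ∈ Q`, `q₁ ≤ q`, both
non-leaking, `q₁ ∉ Q`. -/
theorem not_blockLower_X :
    ¬ BlockLower armX
      {q | mixedRealR endsX 2 UX pX AhX FX σX q ∈ tgtU endsX 5 0 {S : Set (Fin 7) | 6 ∈ S}} := by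
  intro hBL
  have hq : qX ∈ {q | mixedRealR endsX 2 UX pX AhX FX σX q ∈
      tgtU endsX 5 0 {S : Set (Fin 7) | 6 ∈ S}} := by
    simp only [Set.mem_setOf_eq]
    rw [real_qX, mem_tgtU_iff']
    refine ⟨⟨fun h => ?_, fun h => ?_⟩, o_mem_red_X, fun h => ?_⟩
    · rcases red_X_subset h with h | h <;> exact absurd h (by decide)
    · rcases blue_X_subset h with h | h <;> exact absurd h (by decide)
    · rcases blue_X_subset h with h | h <;> exact absurd h (by decide)
  have h1 := hBL qX q1X not_leak_qX not_leak_q1X q1X_le_qX hq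
  simp only [Set.mem_setOf_eq] at h1
  rw [real_q1X, mem_tgtU_iff'] at h1
  exact h1.2.2 o_mem_blue_q1X

end NotLower

end MixedArms

end Summit.Ventures.PercRepro2
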